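import Summits.Ventures.WeilGRH.OnePrimeTransfer
import Literature.NumberTheory.LFunctions.WeilExplicitArchParitySech
import Literature.NumberTheory.LFunctions.WeilMarkovQuadratic
import HarnessLib

/-!
# GRH arm (rh-explicit, venture WeilGRH): transfer of a `ζ` rung to `L(s, χ)` on an ARBITRARY window

Cell `rh-explicit`, WEIL TRACK — GRH ARM.  `OnePrimeTransfer.lean` (weil-grh-2) treats the windows
`2a ≤ log 3` (one prime power inside); this file is the same bookkeeping for every window `[-a, a]`
(the cell's TRANSFER.md inequality, referee-read SOUND, EXTREMALS/GRH/REFEREE-GRH.md): for a Dirichlet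
character `χ` mod `q ≠ 1` and a test function `g` supported in `[-a, a]`, with `k = g ⋆ g̃`,

  `Q_χ(g) = Q_ζ(g) − [k̂(0) + k̂(1)] + (log q)‖g‖₂² + D_χ(k) + (1/2π)[A_{a_χ}(k) − A₀(k)]`,
  `D_χ(k) = Σ_{log n < 2a} Λ(n) n^{-1/2} [(1 − χ(n)) k(log n) + (1 − χ̄(n)) k(−log n)]`

(`weilQuadraticChar_eq_weilQuadratic_add`), where the polar term is `≤ 2(sinh a + a)‖g‖₂²`
(`weilPolar_re_le`), `|D_χ(k)| ≤ 2‖g‖₂² Σ_{log n < 2a} Λ(n) n^{-1/2} |1 − χ(n)|` (`|k(x)| ≤ ‖g‖₂²`,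
`norm_weilConv_weilReflect_le`), and the parity term is `≥ 0`
(`WeilArchParity.re_weilArchIntegralChar_zero_le_one_weilConv_weilReflect`: it equals
`∫ |ĝ(1/2+it)|² π sech(πt) dt` for odd `χ` and `0` for even `χ`).  Hence the

**GENERAL TRANSFER THEOREM** (`weilPositivityOnChar_transfer_window`): if Weil positivity for `ζ` holds on
`[-a, a]` and `B_χ(a) := 2(sinh a + a) + 2 Σ_{log n < 2a} Λ(n) n^{-1/2} |1 − χ(n)| ≤ log q`, then
`WeilPositivityOnChar χ a`.

With the tree's PROVED `ζ` rungs (`weilPositivityOn_log_two_half_holds`, `weilPositivityOn_two_fifths`,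
`weilPositivityOn_log_three_half`, … up to `4023/5000`) every `(q, χ, a)` cell of the GRH arm whose
`B_χ(a) ≤ log q` is a theorem by ONE numerical inequality; the sum runs over the tree's
`weilPrimeIndex a = {n : log n < 2a}` (only prime powers contribute, `Λ(n) = 0` otherwise).
No named facts; RH/GRH-free.

## References

* A. Weil (1952), (11) pp. 261–262 and the «lemme» p. 262 [Weil1952FormulesExplicites];
  H. Yoshida (1992), §6 (6.2) (the polar term) [Yoshida1992].
-/

noncomputable section

open Complex Filter Set MeasureTheory
open scoped Real Topology ComplexConjugate ArithmeticFunction.vonMangoldt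

namespace Summit.Ventures.WeilGRH

open Literature.NumberTheory.LFunctions

variable {q : ℕ} {g : ℝ → ℂ}

/-! ## The twisted prime correction on a general window -/

/-- **The prime correction as a finite sum**: for `k = g ⋆ g̃`, `g` a test function supported in
`[-a, a]`, `P_ζ(k) − P_χ(k) = Σ_{log n < 2a} Λ(n) n^{-1/2} [(1 − χ(n)) k(log n) + (1 − χ̄(n)) k(−log n)]`
(`k(± log n) = 0` once `log n ≥ 2a`). [cite: Weil1952FormulesExplicites, (11) pp. 261–262, prime term] -/
theorem weilPrimeTerm_sub_weilPrimeTermChar_eq_sum (χ : DirichletCharacter ℂ q) (hg : IsWeilTest g)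
    {a : ℝ} (hsupp : tsupport g ⊆ Icc (-a) a) :
    weilPrimeTerm (weilConv g (weilReflect g)) - weilPrimeTermChar χ (weilConv g (weilReflect g)) =
      ∑ n ∈ weilPrimeIndex a, ((Λ n : ℝ) : ℂ) / (Real.sqrt n : ℂ) *
        ((1 - χ (n : ZMod q)) * weilConv g (weilReflect g) (Real.log n) +
          (1 - conj (χ (n : ZMod q))) * weilConv g (weilReflect g) (-Real.log n)) := by
  set k := weilConv g (weilReflect g) with hk
  have hz : ∀ n ∉ weilPrimeIndex a, k (Real.log n) = 0 ∧ k (-Real.log n) = 0 := by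
    intro n hn
    rw [mem_weilPrimeIndex, not_lt] at hn
    have h0 : 0 ≤ Real.log n := Real.log_natCast_nonneg n
    exact ⟨weilConv_weilReflect_eq_zero_of_le_abs hg hsupp (by rwa [abs_of_nonneg h0]),
      weilConv_weilReflect_eq_zero_of_le_abs hg hsupp (by rwa [abs_neg, abs_of_nonneg h0])⟩
  have h1 : weilPrimeTerm k = ∑ n ∈ weilPrimeIndex a,
      ((Λ n : ℝ) : ℂ) / (Real.sqrt n : ℂ) * (k (Real.log n) + k (-Real.log n)) := by
    unfold weilPrimeTerm
    refine tsum_eq_sum fun n hn ↦ ?_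
    rw [(hz n hn).1, (hz n hn).2, add_zero, mul_zero]
  have h2 : weilPrimeTermChar χ k = ∑ n ∈ weilPrimeIndex a,
      ((Λ n : ℝ) : ℂ) / (Real.sqrt n : ℂ) *
        (χ (n : ZMod q) * k (Real.log n) + conj (χ (n : ZMod q)) * k (-Real.log n)) := by
    unfold weilPrimeTermChar
    refine tsum_eq_sum fun n hn ↦ ?_
    rw [(hz n hn).1, (hz n hn).2, mul_zero, mul_zero, add_zero, mul_zero]
  rw [h1, h2, ← Finset.sum_sub_distrib]
  exact Finset.sum_congr rfl fun n _ ↦ by ring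

/-- **Bound on the prime correction**: `|P_ζ(k) − P_χ(k)| ≤ 2‖g‖₂² · Σ_{log n < 2a} Λ(n) n^{-1/2} |1 − χ(n)|`
(`|k(x)| ≤ ‖g‖₂²` by Cauchy–Schwarz, `|1 − χ̄(n)| = |1 − χ(n)|`). [folklore] -/
theorem norm_weilPrimeTerm_sub_weilPrimeTermChar_le_sum (χ : DirichletCharacter ℂ q)
    (hg : IsWeilTest g) {a : ℝ} (hsupp : tsupport g ⊆ Icc (-a) a) :
    ‖weilPrimeTerm (weilConv g (weilReflect g)) - weilPrimeTermChar χ (weilConv g (weilReflect g))‖ ≤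
      2 * (∫ t : ℝ, ‖g t‖ ^ 2) *
        ∑ n ∈ weilPrimeIndex a, (Λ n : ℝ) / Real.sqrt n * ‖1 - χ (n : ZMod q)‖ := by
  set k := weilConv g (weilReflect g) with hk
  set N : ℝ := ∫ t : ℝ, ‖g t‖ ^ 2 with hN
  have hN0 : 0 ≤ N := integral_nonneg fun t ↦ by positivity
  rw [weilPrimeTerm_sub_weilPrimeTermChar_eq_sum χ hg hsupp, Finset.mul_sum]
  refine (norm_sum_le _ _).trans (Finset.sum_le_sum fun n _ ↦ ?_)
  have hΛ : 0 ≤ (Λ n : ℝ) / Real.sqrt n :=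
    div_nonneg ArithmeticFunction.vonMangoldt_nonneg (Real.sqrt_nonneg _)
  have hc : ‖((Λ n : ℝ) : ℂ) / (Real.sqrt n : ℂ)‖ = (Λ n : ℝ) / Real.sqrt n := by
    rw [← Complex.ofReal_div, Complex.norm_real, Real.norm_of_nonneg hΛ]
  have hk1 : ‖k (Real.log n)‖ ≤ N := norm_weilConv_weilReflect_le hg _
  have hk2 : ‖k (-Real.log n)‖ ≤ N := norm_weilConv_weilReflect_le hg _
  have hcj : ‖1 - conj (χ (n : ZMod q))‖ = ‖1 - χ (n : ZMod q)‖ := by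
    rw [show (1 : ℂ) - conj (χ (n : ZMod q)) = conj (1 - χ (n : ZMod q)) by
      rw [map_sub, map_one], Complex.norm_conj]
  have hin : ‖(1 - χ (n : ZMod q)) * k (Real.log n) +
      (1 - conj (χ (n : ZMod q))) * k (-Real.log n)‖ ≤ 2 * N * ‖1 - χ (n : ZMod q)‖ := by
    refine (norm_add_le _ _).trans ?_
    rw [norm_mul, norm_mul, hcj]
    have h0 : 0 ≤ ‖1 - χ (n : ZMod q)‖ := norm_nonneg _
    nlinarith [mul_le_mul_of_nonneg_left hk1 h0, mul_le_mul_of_nonneg_left hk2 h0]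
  rw [norm_mul, hc]
  calc (Λ n : ℝ) / Real.sqrt n *
        ‖(1 - χ (n : ZMod q)) * k (Real.log n) + (1 - conj (χ (n : ZMod q))) * k (-Real.log n)‖
      ≤ (Λ n : ℝ) / Real.sqrt n * (2 * N * ‖1 - χ (n : ZMod q)‖) :=
        mul_le_mul_of_nonneg_left hin hΛ
    _ = 2 * N * ((Λ n : ℝ) / Real.sqrt n * ‖1 - χ (n : ZMod q)‖) := by ring

/-! ## The decomposition `Q_χ = Q_ζ − polar + (log q)‖g‖² + D_χ + parity` -/

/-- **`Q_χ` against `Q_ζ` on any window** (`q ≠ 1`, `k = g ⋆ g̃`, `κ = a_χ`):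
`Q_χ(g) = Q_ζ(g) − [k̂(0) + k̂(1)] + k(0) log q + [P_ζ(k) − P_χ(k)] + (1/2π)[A_κ(k) − A₀(k)]`.
[cite: Weil1952FormulesExplicites, (11) pp. 261–262 (k = ℚ: χ = χ₀ vs χ ≠ χ₀)] -/
theorem weilQuadraticChar_eq_weilQuadratic_add (hq1 : q ≠ 1) (χ : DirichletCharacter ℂ q)
    (g : ℝ → ℂ) :
    weilQuadraticChar χ g =
      weilQuadratic g - weilPolarTerm (weilConv g (weilReflect g)) +
        weilConv g (weilReflect g) 0 * (Real.log q : ℂ) +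
        (weilPrimeTerm (weilConv g (weilReflect g)) - weilPrimeTermChar χ (weilConv g (weilReflect g))) +
        (1 / (2 * π) : ℂ) * (weilArchIntegralChar (charParity χ) (weilConv g (weilReflect g)) -
          weilArchIntegralChar 0 (weilConv g (weilReflect g))) := by
  unfold weilQuadraticChar weilQuadratic weilFunctionalChar weilFunctional weilArchTermChar weilArchTerm
  rw [if_neg hq1, weilArchIntegralChar_zero]
  push_cast
  ring

/-- **The parity term is non-negative** for every character: `Re (1/2π)[A_{a_χ}(k) − A₀(k)] ≥ 0`,
`k = g ⋆ g̃` (`= 0` for even `χ`; `= ½∫|ĝ(1/2+it)|² sech(πt) dt ≥ 0` for odd `χ`,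
`WeilArchParity.weilArchIntegralChar_one_sub_zero_weilConv_weilReflect`).
[cite: Weil1952FormulesExplicites, (10)–(11) pp. 258–262 (K_{1,1} ≤ K_{1,0})] -/
theorem re_parity_term_nonneg (χ : DirichletCharacter ℂ q) (hg : IsWeilTest g) :
    0 ≤ ((1 / (2 * π) : ℂ) * (weilArchIntegralChar (charParity χ) (weilConv g (weilReflect g)) -
      weilArchIntegralChar 0 (weilConv g (weilReflect g)))).re := by
  have hπ : ((1 / (2 * π) : ℂ)) = ((1 / (2 * π) : ℝ) : ℂ) := by push_cast; ring
  rw [hπ, Complex.re_ofReal_mul]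
  refine mul_nonneg (by positivity) ?_
  rw [Complex.sub_re, sub_nonneg]
  have hκ := charParity_le_one χ
  interval_cases h : charParity χ
  · exact le_rfl
  · exact WeilArchParity.re_weilArchIntegralChar_zero_le_one_weilConv_weilReflect hg

/-! ## The general transfer theorem -/

/-- **GENERAL TRANSFER THEOREM.**  Let `χ` be a Dirichlet character mod `q ≠ 1` (any parity, any
values, primitivity not needed) and `a ∈ ℝ`.  If Weil positivity for `ζ` holds on `[-a, a]` and
`2(sinh a + a) + 2 Σ_{log n < 2a} Λ(n) n^{-1/2} |1 − χ(n)| ≤ log q`, then `WeilPositivityOnChar χ a`: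
`Re Q_χ(g) ≥ Re Q_ζ(g) + [log q − 2(sinh a + a) − 2Σ Λ(n)n^{-1/2}|1 − χ(n)|]·‖g‖₂² ≥ 0`.
[cite: Weil1952FormulesExplicites, (11) and the «lemme» p. 262; Yoshida1992, §6 (6.2)] -/
theorem weilPositivityOnChar_transfer_window (hq1 : q ≠ 1) {a : ℝ} (hζ : WeilPositivityOn a)
    (χ : DirichletCharacter ℂ q)
    (hB : 2 * (Real.sinh a + a) +
        2 * ∑ n ∈ weilPrimeIndex a, (Λ n : ℝ) / Real.sqrt n * ‖1 - χ (n : ZMod q)‖ ≤ Real.log q) :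
    WeilPositivityOnChar χ a := by
  intro g hg hsupp
  set k := weilConv g (weilReflect g) with hk
  set N : ℝ := ∫ t : ℝ, ‖g t‖ ^ 2 with hN
  set S : ℝ := ∑ n ∈ weilPrimeIndex a, (Λ n : ℝ) / Real.sqrt n * ‖1 - χ (n : ZMod q)‖ with hS
  set D : ℂ := weilPrimeTerm k - weilPrimeTermChar χ k with hD
  set Par : ℂ := (1 / (2 * π) : ℂ) * (weilArchIntegralChar (charParity χ) k -
    weilArchIntegralChar 0 k) with hPar
  have hN0 : 0 ≤ N := integral_nonneg fun t ↦ by positivity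
  have hk0 : k 0 = ((N : ℝ) : ℂ) := by rw [hk, hN, weilConv_weilReflect_apply_zero]
  have hre : (weilQuadraticChar χ g).re = (weilQuadratic g).re -
      2 * (weilMellin g 0 * conj (weilMellin g 1)).re + N * Real.log q + D.re + Par.re := by
    rw [weilQuadraticChar_eq_weilQuadratic_add hq1 χ g, ← hk, weilPolarTerm_weilConv_weilReflect hg,
      hk0, ← hD, ← hPar]
    simp only [sub_re, add_re, Complex.ofReal_re, mul_re, Complex.ofReal_im, mul_zero, sub_zero]
  have hζg : 0 ≤ (weilQuadratic g).re := hζ g hg hsupp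
  have hP : 2 * (weilMellin g 0 * conj (weilMellin g 1)).re ≤ 2 * (Real.sinh a + a) * N :=
    weilPolar_re_le hg hsupp
  have hDn : ‖D‖ ≤ 2 * N * S := norm_weilPrimeTerm_sub_weilPrimeTermChar_le_sum χ hg hsupp
  have hDre : -(2 * N * S) ≤ D.re := by
    have := (abs_le.1 (Complex.abs_re_le_norm D)).1
    linarith
  have hpar : 0 ≤ Par.re := re_parity_term_nonneg χ hg
  rw [hre]
  nlinarith [mul_le_mul_of_nonneg_right hB hN0]

/-- The same with the `ζ` rung supplied as any of the tree's PROVED windows, packaged for the base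
rung of Yoshida's ladder: `a ≤ (log 3)/2`-free version — **if `WeilPositivityOn a` is a theorem and
`B_χ(a) ≤ log q` then `C_χ(a)`**; instance `a = (log 3)/2` (`weilPositivityOn_log_three_half`).
[cite: Yoshida1992, Thm 1 (p. 310); Weil1952FormulesExplicites, the «lemme» p. 262] -/
theorem weilPositivityOnChar_log_three_half_of_bound (hq1 : q ≠ 1) (χ : DirichletCharacter ℂ q)
    (hB : 2 * (Real.sinh (Real.log 3 / 2) + Real.log 3 / 2) +
        2 * ∑ n ∈ weilPrimeIndex (Real.log 3 / 2),
          (Λ n : ℝ) / Real.sqrt n * ‖1 - χ (n : ZMod q)‖ ≤ Real.log q) :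
    WeilPositivityOnChar χ (Real.log 3 / 2) :=
  weilPositivityOnChar_transfer_window hq1 weilPositivityOn_log_three_half χ hB

end Summit.Ventures.WeilGRH

end
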